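import Summits.Ventures.YMGap.Thresholds.RegionBoundaryTiltLipschitz
import HarnessLib

/-!
# Venture YMGap — BOUNDARY INSENSITIVITY OF THE DLR KERNELS by exponential tilting, III:
# telescoping over the collar; the boundary-influence bound (OBJECT U, piece U3, file 3 of 3)

HONEST FRAMING: venture file (cell `pub-ymgap`, track (a), seat p2). WHAT THIS IS: from ANY covariance
bound for the DLR kernels `γ_E(·|η) = ymSpecification ρ (Nβ) E η` of `SU(N)` lattice Yang–Mills that
decays at rate `κ` in the integer sup-norm separation of the per-link Lipschitz data (constant `A`,
uniform in `E` and `η` — the conclusion shape of the region covariance theorem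
`kernel_covariance_exp_decay` of seat lit-1 once the off-diagonal Hessian data are plugged in; it enters
HERE AS A HYPOTHESIS), the boundary influence on cylinder expectations is exponentially small: for
`Λ ⊆ E`, ANY `η, η'`, every smooth `f` on `(Λ → M_N(ℂ))` with per-link Lipschitz data `δ ≥ 0`,

  `|γ_E(f|η) - γ_E(f|η')| ≤ C · (∑_e δ_e) · ∑_{b ∈ collar E} e^{-κ · setDistEdges Λ {b}}`,
  `collar E = ((plaquettesTouching E).biUnion plaquetteEdges) \ E`,  `C = A e^{2w₀+κ} · 2N^{3/2}|β| · 8(d-1)`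

(`kernel_boundary_influence_le_of_cov`, and the `∃ κ C` form `kernel_boundary_influence_le` consumed by
the DLR-uniqueness assembly of seat p1). Proof: telescoping over the collar one link at a time
(`abs_sub_le_sum_of_one_link`), each step being the tilt bound of file I with the one-link data of
file II fed into the covariance hypothesis. WHAT IT IS NOT: no covariance bound is proved here, and no
uniqueness / mass-gap statement.

## References

* H.-O. Georgii, Gibbs Measures and Phase Transitions, 2nd ed. (2011), Ch. 8 (uniqueness from the
  decay of the boundary dependence of the kernels).
* B. Helffer, J. Funct. Anal. 155 (1998) 571–586.
* H. Shen, R. Zhu, X. Zhu, CMP 400 (2023) 805–851, §5.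
-/

noncomputable section

open scoped Matrix ComplexConjugate BigOperators Matrix.Norms.Frobenius ContDiff Topology ProbabilityTheory
open Matrix Complex Finset MeasureTheory Filter ProbabilityTheory
open Literature.MathematicalPhysics.QuantumFieldTheory
open Literature.MathematicalPhysics.QuantumLattice (fundamentalRep continuous_fundamentalRep fundamentalRep_apply
  fundamentalRep_mem_unitaryGroup LGConfig ZdPlaquette plaquettesTouching plaquetteEdges mem_plaquettesTouching_iff
  plaquetteObs isCylinder_plaquetteObs abs_plaquetteObs_le_holds wilsonBoundaryAction ymSpecification
  isProbabilityMeasure_ymSpecification)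
open Literature.Probability.LatticeModels (glueWith glueWith_apply_mem glueWith_apply_not_mem measurable_glueWith Site.supNorm
  Site.supNorm_le_iff Site.supNorm_add_le Site.norm_eq_supNorm)
open Literature.MathematicalPhysics.QuantumFieldTheory.SUNBakryEmery (SUN)

namespace Summit.Ventures.YMGap

namespace LatticeBakryEmery

variable {d N : ℕ}

/-! ### Telescoping over the collar -/

/-- **Telescoping over a finite set of links.** If changing the exterior at any single link
`b ∈ B` (with an arbitrary background) moves `Φ` by at most `ε b`, then replacing `η` by `η'` on all
of `B` moves `Φ` by at most `∑_{b ∈ B} ε b`. -/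
theorem abs_sub_le_sum_of_one_link {Φ : LGConfig d (SUN N) → ℝ}
    {ε : Literature.MathematicalPhysics.QuantumFieldTheory.ZdEdge d → ℝ}
    (B : Finset (Literature.MathematicalPhysics.QuantumFieldTheory.ZdEdge d))
    (h : ∀ b ∈ B, ∀ ξ ξ' : LGConfig d (SUN N), (∀ e, e ≠ b → ξ' e = ξ e) → |Φ ξ' - Φ ξ| ≤ ε b)
    (η η' : LGConfig d (SUN N)) :
    |Φ (B.piecewise η' η) - Φ η| ≤ ∑ b ∈ B, ε b := by
  classical
  induction B using Finset.induction_on with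
  | empty => simp
  | @insert b T hbT ih =>
    have ih' := ih fun b' hb' => h b' (Finset.mem_insert_of_mem hb')
    rw [Finset.sum_insert hbT, Finset.piecewise_insert]
    have hstep : |Φ (Function.update (T.piecewise η' η) b (η' b)) - Φ (T.piecewise η' η)| ≤ ε b :=
      h b (Finset.mem_insert_self b T) _ _ fun e he => Function.update_of_ne he _ _
    calc |Φ (Function.update (T.piecewise η' η) b (η' b)) - Φ η|
        = |(Φ (Function.update (T.piecewise η' η) b (η' b)) - Φ (T.piecewise η' η)) + (Φ (T.piecewise η' η) - Φ η)| := by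
          ring_nf
      _ ≤ |Φ (Function.update (T.piecewise η' η) b (η' b)) - Φ (T.piecewise η' η)| + |Φ (T.piecewise η' η) - Φ η| :=
          abs_add_le _ _
      _ ≤ ε b + ∑ b' ∈ T, ε b' := add_le_add hstep ih'

/-- Replacing the exterior by `η'` on the whole collar is, for kernel expectations of `E`-cylinders,
the same as replacing it by `η'` everywhere. -/
theorem kernel_integral_piecewise_collar (E : Finset (Literature.MathematicalPhysics.QuantumFieldTheory.ZdEdge d))
    (η η' : LGConfig d (SUN N)) (β : ℝ) {u : Cfg ↥E N → ℝ} (hu : Continuous u) :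
    ∫ U, matrixCylinder E u U ∂(ymSpecification (fundamentalRep (Fin N)) ((N : ℝ) * β) E
        ((((plaquettesTouching E).biUnion plaquetteEdges) \ E).piecewise η' η)) =
      ∫ U, matrixCylinder E u U ∂(ymSpecification (fundamentalRep (Fin N)) ((N : ℝ) * β) E η') := by
  classical
  refine kernel_integral_congr E β (fun e he => ?_) hu
  rw [Finset.piecewise_eq_of_mem _ _ _ he]

/-! ### Re-basing a `Λ`-cylinder to a larger region `E ⊇ Λ` -/

/-- A `Λ`-cylinder is an `E`-cylinder for `Λ ⊆ E` (same observable). -/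
theorem matrixCylinder_rebase {E Λ : Finset (Literature.MathematicalPhysics.QuantumFieldTheory.ZdEdge d)} (hΛE : Λ ⊆ E)
    (f : Cfg ↥Λ N → ℝ) :
    matrixCylinder E (fun Q : Cfg ↥E N => f fun e : ↥Λ => Q ⟨e, hΛE e.2⟩) = matrixCylinder Λ f := rfl

/-- Re-basing preserves smoothness. -/
theorem contDiff_rebase {E Λ : Finset (Literature.MathematicalPhysics.QuantumFieldTheory.ZdEdge d)} (hΛE : Λ ⊆ E)
    {f : Cfg ↥Λ N → ℝ} (hf : ContDiff ℝ ∞ f) :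
    ContDiff ℝ ∞ (fun Q : Cfg ↥E N => f fun e : ↥Λ => Q ⟨e, hΛE e.2⟩) :=
  hf.comp (contDiff_pi.2 fun e =>
    contDiff_apply ℝ (Matrix (Fin N) (Fin N) ℂ)
      (⟨(e : Literature.MathematicalPhysics.QuantumFieldTheory.ZdEdge d), hΛE e.2⟩ : ↥E))

/-- Re-basing preserves the per-link Lipschitz data (extended by zero off `Λ`). -/
theorem linkLipschitz_rebase {E Λ : Finset (Literature.MathematicalPhysics.QuantumFieldTheory.ZdEdge d)} (hΛE : Λ ⊆ E)
    {f : Cfg ↥Λ N → ℝ} {δ : ↥Λ → ℝ} (hLip : LinkLipschitz f δ) :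
    LinkLipschitz (fun Q : Cfg ↥E N => f fun e : ↥Λ => Q ⟨e, hΛE e.2⟩)
      fun e : ↥E => if h : (e : Literature.MathematicalPhysics.QuantumFieldTheory.ZdEdge d) ∈ Λ then δ ⟨e, h⟩ else 0 := by
  intro e g h hgh
  set g' : PSU ↥Λ N := fun x => g ⟨x, hΛE x.2⟩ with hg'
  set h' : PSU ↥Λ N := fun x => h ⟨x, hΛE x.2⟩ with hh'
  have eg : (fun Q : Cfg ↥E N => f fun e : ↥Λ => Q ⟨e, hΛE e.2⟩) (emb g) = f (emb g') := rfl
  have eh : (fun Q : Cfg ↥E N => f fun e : ↥Λ => Q ⟨e, hΛE e.2⟩) (emb h) = f (emb h') := rfl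
  rw [eg, eh]
  change |f (emb g') - f (emb h')| ≤
    (if h : (e : Literature.MathematicalPhysics.QuantumFieldTheory.ZdEdge d) ∈ Λ then δ ⟨e, h⟩ else 0) *
      suFrobDist (g e) (h e)
  by_cases heΛ : (e : Literature.MathematicalPhysics.QuantumFieldTheory.ZdEdge d) ∈ Λ
  · rw [dif_pos heΛ]
    set e₀ : ↥Λ := ⟨(e : Literature.MathematicalPhysics.QuantumFieldTheory.ZdEdge d), heΛ⟩ with he₀
    have hgh' : ∀ x : ↥Λ, x ≠ e₀ → g' x = h' x := by
      intro x hx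
      have hne : (⟨(x : Literature.MathematicalPhysics.QuantumFieldTheory.ZdEdge d), hΛE x.2⟩ : ↥E) ≠ e := by
        intro hxe
        apply hx
        apply Subtype.ext
        have := congrArg Subtype.val hxe
        simpa [he₀] using this
      exact hgh _ hne
    have key := hLip e₀ g' h' hgh'
    have hge : g' e₀ = g e := by simp only [hg', he₀]
    have hhe : h' e₀ = h e := by simp only [hh', he₀]
    rwa [hge, hhe] at key
  · rw [dif_neg heΛ, zero_mul]
    have hgh' : g' = h' := by
      funext x
      have hne : (⟨(x : Literature.MathematicalPhysics.QuantumFieldTheory.ZdEdge d), hΛE x.2⟩ : ↥E) ≠ e := by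
        intro hxe
        apply heΛ
        have := congrArg Subtype.val hxe
        simp only at this
        rw [← this]
        exact x.2
      exact hgh _ hne
    rw [hgh', sub_self, abs_zero]

/-- The re-based Lipschitz data have the same total size. -/
theorem sum_rebase {E Λ : Finset (Literature.MathematicalPhysics.QuantumFieldTheory.ZdEdge d)} (hΛE : Λ ⊆ E) (δ : ↥Λ → ℝ) :
    ∑ e : ↥E, (if h : (e : Literature.MathematicalPhysics.QuantumFieldTheory.ZdEdge d) ∈ Λ then δ ⟨e, h⟩ else 0) = ∑ e, δ e := by
  classical
  set δ' : Literature.MathematicalPhysics.QuantumFieldTheory.ZdEdge d → ℝ := fun x => if h : x ∈ Λ then δ ⟨x, h⟩ else 0 with hδ'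
  have h1 : ∑ e : ↥E, (if h : (e : Literature.MathematicalPhysics.QuantumFieldTheory.ZdEdge d) ∈ Λ then δ ⟨e, h⟩ else 0) =
      ∑ x ∈ E, δ' x := Finset.sum_coe_sort E δ'
  have h2 : ∑ x ∈ Λ, δ' x = ∑ x ∈ E, δ' x :=
    Finset.sum_subset hΛE fun x _ hx => by simp only [hδ', dif_neg hx]
  have h3 : ∑ e : ↥Λ, δ' e = ∑ x ∈ Λ, δ' x := Finset.sum_coe_sort Λ δ'
  rw [h1, ← h2, ← h3]
  refine Finset.sum_congr rfl fun e _ => ?_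
  simp only [hδ', dif_pos e.2]

/-! ### The boundary-influence bound -/

/-- The set-to-set distance from `Λ` to `{b}` is at most the integer sup-norm distance of base points
from any `e ∈ Λ` to `b`. -/
theorem setDistEdges_singleton_le {Λ : Finset (Literature.MathematicalPhysics.QuantumFieldTheory.ZdEdge d)}
    {e b : Literature.MathematicalPhysics.QuantumFieldTheory.ZdEdge d} (he : e ∈ Λ) :
    setDistEdges Λ {b} ≤ (Site.supNorm (e.1 - b.1) : ℝ) := by
  rw [← Site.norm_eq_supNorm]
  exact setDistEdges_le_norm_sub he (Finset.mem_singleton_self b)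

/-- **OBJECT U, piece U3 — boundary influence on the DLR kernels from covariance decay.**
Suppose the kernels `γ_E(·|η)` at 't Hooft coupling `β` satisfy a covariance bound decaying at rate
`κ > 0` in the sup-norm separation of the Lipschitz data, with constant `A`, uniformly in `E` and `η`
(hypothesis `hcov`; this is the conclusion of the region covariance theorem
`kernel_covariance_exp_decay` once the off-diagonal Hessian data of `regionPot` are plugged in). Then
for `Λ ⊆ E`, ANY two exterior configurations `η, η'`, and every smooth `f` on `(Λ → M_N(ℂ))` with
per-link Lipschitz data `δ ≥ 0` on `SU(N)^Λ`:

  `|γ_E(f|η) - γ_E(f|η')| ≤ C · (∑_e δ_e) · ∑_{b ∈ collar E} e^{-κ · setDistEdges Λ {b}}`,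

`collar E = ((plaquettesTouching E).biUnion plaquetteEdges) \ E`, with the explicit constant
`C = A · e^{2w₀ + κ} · 2N^{3/2}|β| · 8(d-1)`, `w₀ = 4(d-1)N²|β|`. -/
theorem kernel_boundary_influence_le_of_cov {β A κ : ℝ} (hκ : 0 < κ) (hA : 0 ≤ A)
    (hcov : ∀ (E : Finset (Literature.MathematicalPhysics.QuantumFieldTheory.ZdEdge d)) (η : LGConfig d (SUN N))
      (u v : Cfg ↥E N → ℝ), ContDiff ℝ ∞ u → ContDiff ℝ ∞ v →
      ∀ (δu δv : ↥E → ℝ), (∀ e, 0 ≤ δu e) → (∀ e, 0 ≤ δv e) → LinkLipschitz u δu → LinkLipschitz v δv →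
      ∀ (m : ℕ), (∀ e e', δu e ≠ 0 → δv e' ≠ 0 → m ≤ Site.supNorm (e.1.1 - e'.1.1)) →
      |cov[matrixCylinder E u, matrixCylinder E v; ymSpecification (fundamentalRep (Fin N)) ((N : ℝ) * β) E η]| ≤
        A * Real.exp (-κ * m) * (∑ e, δu e) * (∑ e, δv e))
    (E Λ : Finset (Literature.MathematicalPhysics.QuantumFieldTheory.ZdEdge d)) (hΛE : Λ ⊆ E)
    (η η' : LGConfig d (SUN N)) {f : Cfg ↥Λ N → ℝ} (hf : ContDiff ℝ ∞ f)
    {δ : ↥Λ → ℝ} (hδ : ∀ e, 0 ≤ δ e) (hLip : LinkLipschitz f δ) :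
    |∫ U, matrixCylinder Λ f U ∂(ymSpecification (fundamentalRep (Fin N)) ((N : ℝ) * β) E η) -
        ∫ U, matrixCylinder Λ f U ∂(ymSpecification (fundamentalRep (Fin N)) ((N : ℝ) * β) E η')| ≤
      (A * Real.exp (2 * ((N : ℝ) * |β| * (2 * N) * (2 * (d - 1) : ℕ)) + κ) * ((N : ℝ) * |β| * (2 * Real.sqrt N)) *
          (4 * (2 * (d - 1) : ℕ))) * (∑ e, δ e) *
        ∑ b ∈ ((plaquettesTouching E).biUnion plaquetteEdges) \ E, Real.exp (-κ * setDistEdges Λ {b}) := by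
  classical
  set w₀ : ℝ := (N : ℝ) * |β| * (2 * N) * (2 * (d - 1) : ℕ) with hw₀
  set c₁ : ℝ := (N : ℝ) * |β| * (2 * Real.sqrt N) with hc₁
  set c₂ : ℝ := (4 * (2 * (d - 1) : ℕ)) with hc₂
  set B := ((plaquettesTouching E).biUnion plaquetteEdges) \ E with hB
  -- the re-based observable
  set fE : Cfg ↥E N → ℝ := fun Q => f fun e : ↥Λ => Q ⟨e, hΛE e.2⟩ with hfE
  set δE : ↥E → ℝ := fun e =>
    if h : (e : Literature.MathematicalPhysics.QuantumFieldTheory.ZdEdge d) ∈ Λ then δ ⟨e, h⟩ else 0 with hδE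
  have hfEc : ContDiff ℝ ∞ fE := contDiff_rebase hΛE hf
  have hδE0 : ∀ e, 0 ≤ δE e := by
    intro e; simp only [hδE]; split_ifs; exacts [hδ _, le_rfl]
  have hLipE : LinkLipschitz fE δE := linkLipschitz_rebase hΛE hLip
  have hsumδ : ∑ e, δE e = ∑ e, δ e := sum_rebase hΛE δ
  have hδsum0 : 0 ≤ ∑ e, δ e := Finset.sum_nonneg fun e _ => hδ e
  -- the boundary functional
  set Φ : LGConfig d (SUN N) → ℝ := fun ξ =>
    ∫ U, matrixCylinder E fE U ∂(ymSpecification (fundamentalRep (Fin N)) ((N : ℝ) * β) E ξ) with hΦ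
  -- the integer distance from `Λ` to a link `b`
  set Dst : Literature.MathematicalPhysics.QuantumFieldTheory.ZdEdge d → ℕ := fun b =>
    if hΛ : Λ.Nonempty then Λ.inf' hΛ (fun e => Site.supNorm (e.1 - b.1)) else 0 with hDst
  have hDst_le : ∀ b, ∀ e ∈ Λ, Dst b ≤ Site.supNorm (e.1 - b.1) := by
    intro b e he
    have hΛ : Λ.Nonempty := ⟨e, he⟩
    have hD : Dst b = Λ.inf' hΛ (fun e => Site.supNorm (e.1 - b.1)) := by simp only [hDst, dif_pos hΛ]
    rw [hD]
    exact Finset.inf'_le (fun e : Literature.MathematicalPhysics.QuantumFieldTheory.ZdEdge d =>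
      Site.supNorm (e.1 - b.1)) he
  have hsd_le : ∀ b, setDistEdges Λ {b} ≤ (Dst b : ℝ) := by
    intro b
    by_cases hΛ : Λ.Nonempty
    · obtain ⟨e₀, he₀, hmin⟩ := Finset.exists_mem_eq_inf' hΛ (fun e => Site.supNorm (e.1 - b.1))
      have : Dst b = Site.supNorm (e₀.1 - b.1) := by simp only [hDst, dif_pos hΛ]; exact hmin
      rw [this]
      exact setDistEdges_singleton_le he₀
    · have hp : ¬ (Λ ×ˢ ({b} : Finset _)).Nonempty := fun ⟨q, hq⟩ => hΛ ⟨q.1, (Finset.mem_product.1 hq).1⟩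
      rw [setDistEdges, dif_neg hp]
      exact Nat.cast_nonneg _
  -- the one-link error
  set ε : Literature.MathematicalPhysics.QuantumFieldTheory.ZdEdge d → ℝ := fun b =>
    Real.exp w₀ * (A * Real.exp (-κ * ((Dst b - 1 : ℕ) : ℝ)) * (∑ e, δ e) * (Real.exp w₀ * c₁ * c₂)) with hε
  have hstep : ∀ b ∈ B, ∀ ξ ξ' : LGConfig d (SUN N), (∀ e, e ≠ b → ξ' e = ξ e) → |Φ ξ' - Φ ξ| ≤ ε b := by
    intro b _ ξ ξ' hξ
    have h1 := abs_kernel_integral_sub_le E ξ ξ' β hfEc.continuous (abs_tilt_le_of_eq_off E β hξ)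
    have hgc : ContDiff ℝ ∞ (fun Q : Cfg ↥E N => Real.exp (regionPot E ξ' β Q - regionPot E ξ β Q)) :=
      Real.contDiff_exp.comp ((contDiff_regionPot E ξ' β).sub (contDiff_regionPot E ξ β))
    -- separation of the Lipschitz data: `Λ` versus the plaquettes through `b`
    have hsep : ∀ e e' : ↥E, δE e ≠ 0 →
        Real.exp w₀ * c₁ * (((plaquettesTouching E).filter fun p => b ∈ plaquetteEdges p ∧
          (e' : Literature.MathematicalPhysics.QuantumFieldTheory.ZdEdge d) ∈ plaquetteEdges p).card : ℝ) ≠ 0 →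
        (Dst b - 1 : ℕ) ≤ Site.supNorm (e.1.1 - e'.1.1) := by
      intro e e' hne hne'
      have heΛ : (e : Literature.MathematicalPhysics.QuantumFieldTheory.ZdEdge d) ∈ Λ := by
        by_contra hc
        exact hne (by simp only [hδE, dif_neg hc])
      have hcard : ((plaquettesTouching E).filter fun p => b ∈ plaquetteEdges p ∧
          (e' : Literature.MathematicalPhysics.QuantumFieldTheory.ZdEdge d) ∈ plaquetteEdges p).Nonempty := by
        rw [← Finset.card_pos, Nat.pos_iff_ne_zero]
        intro h0
        apply hne'
        rw [h0, Nat.cast_zero, mul_zero]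
      obtain ⟨p, hp⟩ := hcard
      obtain ⟨-, hbp, he'p⟩ := Finset.mem_filter.1 hp
      have hnear : Site.supNorm (e'.1.1 - b.1) ≤ 1 := supNorm_sub_le_one_of_common_plaquette he'p hbp
      have hfar : Dst b ≤ Site.supNorm (e.1.1 - b.1) := hDst_le b _ heΛ
      have htri : Site.supNorm (e.1.1 - b.1) ≤ Site.supNorm (e.1.1 - e'.1.1) + Site.supNorm (e'.1.1 - b.1) := by
        have := Site.supNorm_add_le (e.1.1 - e'.1.1) (e'.1.1 - b.1)
        rwa [sub_add_sub_cancel] at this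
      omega
    have h2 := hcov E ξ fE _ hfEc hgc δE _ hδE0 (tiltLipschitzData_nonneg E β b) hLipE
      (linkLipschitz_exp_tilt E β hξ) (Dst b - 1) hsep
    have h3 : ∑ e' : ↥E, Real.exp w₀ * c₁ * (((plaquettesTouching E).filter fun p => b ∈ plaquetteEdges p ∧
        (e' : Literature.MathematicalPhysics.QuantumFieldTheory.ZdEdge d) ∈ plaquetteEdges p).card : ℝ) ≤
        Real.exp w₀ * c₁ * c₂ := by
      rw [← Finset.mul_sum]
      exact mul_le_mul_of_nonneg_left (sum_card_filter_common_plaquette_le E b) (by positivity)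
    rw [hsumδ] at h2
    have hK0 : 0 ≤ A * Real.exp (-κ * ((Dst b - 1 : ℕ) : ℝ)) * ∑ e, δ e := by positivity
    calc |Φ ξ' - Φ ξ| ≤ Real.exp w₀ * |cov[matrixCylinder E fE, matrixCylinder E fun Q : Cfg ↥E N =>
            Real.exp (regionPot E ξ' β Q - regionPot E ξ β Q); ymSpecification (fundamentalRep (Fin N)) ((N : ℝ) * β) E ξ]| := h1
      _ ≤ Real.exp w₀ * (A * Real.exp (-κ * ((Dst b - 1 : ℕ) : ℝ)) * (∑ e, δ e) *
            ∑ e' : ↥E, Real.exp w₀ * c₁ * (((plaquettesTouching E).filter fun p => b ∈ plaquetteEdges p ∧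
              (e' : Literature.MathematicalPhysics.QuantumFieldTheory.ZdEdge d) ∈ plaquetteEdges p).card : ℝ)) :=
          mul_le_mul_of_nonneg_left h2 (Real.exp_pos _).le
      _ ≤ Real.exp w₀ * (A * Real.exp (-κ * ((Dst b - 1 : ℕ) : ℝ)) * (∑ e, δ e) * (Real.exp w₀ * c₁ * c₂)) :=
          mul_le_mul_of_nonneg_left (mul_le_mul_of_nonneg_left h3 hK0) (Real.exp_pos _).le
      _ = ε b := rfl
  -- telescoping over the collar
  have htel := abs_sub_le_sum_of_one_link B hstep η η'
  have hpw : Φ (B.piecewise η' η) = Φ η' := kernel_integral_piecewise_collar E η η' β hfEc.continuous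
  rw [hpw] at htel
  have eη : ∫ U, matrixCylinder Λ f U ∂(ymSpecification (fundamentalRep (Fin N)) ((N : ℝ) * β) E η) = Φ η := rfl
  have eη' : ∫ U, matrixCylinder Λ f U ∂(ymSpecification (fundamentalRep (Fin N)) ((N : ℝ) * β) E η') = Φ η' := rfl
  rw [eη, eη', abs_sub_comm]
  refine htel.trans ?_
  rw [Finset.mul_sum]
  refine Finset.sum_le_sum fun b _ => ?_
  -- `ε b ≤ C · (∑ δ) · e^{-κ d(Λ,b)}`
  have hexp : Real.exp (-κ * ((Dst b - 1 : ℕ) : ℝ)) ≤ Real.exp κ * Real.exp (-κ * setDistEdges Λ {b}) := by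
    rw [← Real.exp_add]
    refine Real.exp_le_exp.2 ?_
    have h1 : (Dst b : ℝ) ≤ ((Dst b - 1 : ℕ) : ℝ) + 1 := by exact_mod_cast le_tsub_add
    have h2 := hsd_le b
    nlinarith
  have hrest : 0 ≤ Real.exp w₀ * (A * (∑ e, δ e) * (Real.exp w₀ * c₁ * c₂)) := by positivity
  calc ε b = Real.exp (-κ * ((Dst b - 1 : ℕ) : ℝ)) * (Real.exp w₀ * (A * (∑ e, δ e) * (Real.exp w₀ * c₁ * c₂))) := by
        simp only [hε]; ring
    _ ≤ (Real.exp κ * Real.exp (-κ * setDistEdges Λ {b})) * (Real.exp w₀ * (A * (∑ e, δ e) * (Real.exp w₀ * c₁ * c₂))) :=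
        mul_le_mul_of_nonneg_right hexp hrest
    _ = A * Real.exp (2 * w₀ + κ) * c₁ * c₂ * (∑ e, δ e) * Real.exp (-κ * setDistEdges Λ {b}) := by
        rw [show (2 : ℝ) * w₀ + κ = w₀ + w₀ + κ by ring, Real.exp_add, Real.exp_add]
        ring

/-- **★ U3 (the shape consumed by the DLR-uniqueness assembly).** From a kernel covariance bound
decaying in the separation of the Lipschitz data (rate `κ > 0`, constant `A`, uniform in the region
and the boundary condition) to exponentially small boundary influence: there are `κ > 0` and `C ≥ 0`,
depending only on `(d, N, β)` and the covariance data, with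
`|γ_E(f|η) - γ_E(f|η')| ≤ C · (∑_e δ_e) · ∑_{b ∈ collar E} e^{-κ · setDistEdges Λ {b}}` for all
`Λ ⊆ E`, all `η, η'`, all smooth per-link Lipschitz `f`. -/
theorem kernel_boundary_influence_le {β A : ℝ} (hA : 0 ≤ A)
    (hT : ∃ κ : ℝ, 0 < κ ∧ ∀ (E : Finset (Literature.MathematicalPhysics.QuantumFieldTheory.ZdEdge d)) (η : LGConfig d (SUN N))
      (u v : Cfg ↥E N → ℝ), ContDiff ℝ ∞ u → ContDiff ℝ ∞ v →
      ∀ (δu δv : ↥E → ℝ), (∀ e, 0 ≤ δu e) → (∀ e, 0 ≤ δv e) → LinkLipschitz u δu → LinkLipschitz v δv →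
      ∀ (m : ℕ), (∀ e e', δu e ≠ 0 → δv e' ≠ 0 → m ≤ Site.supNorm (e.1.1 - e'.1.1)) →
      |cov[matrixCylinder E u, matrixCylinder E v; ymSpecification (fundamentalRep (Fin N)) ((N : ℝ) * β) E η]| ≤
        A * Real.exp (-κ * m) * (∑ e, δu e) * (∑ e, δv e)) :
    ∃ κ C : ℝ, 0 < κ ∧ 0 ≤ C ∧
      ∀ (E Λ : Finset (Literature.MathematicalPhysics.QuantumFieldTheory.ZdEdge d)), Λ ⊆ E →
      ∀ (η η' : LGConfig d (SUN N)) (f : Cfg ↥Λ N → ℝ), ContDiff ℝ ∞ f →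
      ∀ (δ : ↥Λ → ℝ), (∀ e, 0 ≤ δ e) → LinkLipschitz f δ →
      |∫ U, matrixCylinder Λ f U ∂(ymSpecification (fundamentalRep (Fin N)) ((N : ℝ) * β) E η) -
          ∫ U, matrixCylinder Λ f U ∂(ymSpecification (fundamentalRep (Fin N)) ((N : ℝ) * β) E η')| ≤
        C * (∑ e, δ e) *
          ∑ b ∈ ((plaquettesTouching E).biUnion plaquetteEdges) \ E, Real.exp (-κ * setDistEdges Λ {b}) := by
  obtain ⟨κ, hκ, hcov⟩ := hT
  refine ⟨κ, A * Real.exp (2 * ((N : ℝ) * |β| * (2 * N) * (2 * (d - 1) : ℕ)) + κ) *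
    ((N : ℝ) * |β| * (2 * Real.sqrt N)) * (4 * (2 * (d - 1) : ℕ)), hκ, by positivity, ?_⟩
  intro E Λ hΛE η η' f hf δ hδ hLip
  exact kernel_boundary_influence_le_of_cov hκ hA hcov E Λ hΛE η η' hf hδ hLip

end LatticeBakryEmery

end Summit.Ventures.YMGap
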